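import Literature.AlgebraicGeometry.Frobenioids.AnchorCriteria
import Literature.AlgebraicGeometry.Frobenioids.ArchimedeanSlitMorphisms
import Literature.AlgebraicGeometry.Frobenioids.ArchimedeanProp35iCounterexample
import HarnessLib

/-!
# Frobenioids II, Proposition 3.5 (iii) for the rigidified angloid `R`: ANCHOR TRANSFER along
# `R = R₀ ×_{D₀} D → D` (sub-DAG row P35-L06 `AngloidRCIsoSubanchor`, positive half; proof-only)

Mochizuki, *The geometry of Frobenioids II: poly-Frobenioids*, Kyushu J. Math. **62** (2008) 401–460,
§3, Proposition 3.5 (iii) p. 34, proof p. 35 ll. 28–40 [cite: MochizukiFrdII2008, Prop 3.5 (iii) p.34]: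
"… it suffices to show that `C` is an anchor of `G[ℂ]`. Let `φ : C → C'` be an irreducible morphism of
`G[ℂ]` … `φ` is either a pull-back morphism or an isometric pre-step … the finiteness of the collection of
isomorphism classes of `^C G` arising from such `φ` then follows immediately from the fact that `C_D` is an
anchor of `D[ℂ]` (respectively, from Lemma 3.2, (iii), (vii))."

This PROOF-ONLY file carries out that argument for `G = R = R₀ ×_{D₀} D` ([FrdII] Ex. 3.3 (iv)) over an
ARBITRARY base `π : D → D₀`, relative to the RC-structure `R → C → D → D₀ → ArchBase` of the typed
instance `ArchFrd.Prop35iii_R` (abc-iut-L1-t9), in the kernel vocabulary of [FrdI] §0 / [FrdII] Def.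
3.1 (v) (`IsIrreducibleHom`, `IsAnchor`, `RC.IsRCAnchor`, `RC.ComplexPart`):

* `R.fst_isIso_or_snd_isIso_of_irreducible` — an irreducible arrow `φ = (φ₀, φ_D)` of `R[ℂ]` has an
  invertible `R₀`-component or an invertible `D`-component (it factors as `(φ₀, id) ≫ (id, φ_D)` through
  the complex object `(codomain of φ₀, domain of φ_D)` — the two "kinds" of print: pull-back morphisms
  `(iso, φ_D)` and isometric pre-steps `(φ₀, iso)`);
* `R.irreducible_snd_of_irreducible` — for the first kind, `φ_D` is irreducible in `D[ℂ]`;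
  `R.irreducible_fst_of_irreducible` — for the second kind, `φ₀` is irreducible in `R₀`;
* `R.nonempty_under_iso` — two arrows out of `X` in `R[ℂ]` whose `R₀`- and `D`-components are
  isomorphic under `X₀` resp. `X_D` are isomorphic under `X` (the compatibility square is automatic);
* **`R.isRCAnchor_of_isRCAnchor_snd`** — if `X_D` is an RC-anchor of `D` and any two IRREDUCIBLE
  `R₀`-arrows out of `X₀` with complex codomains are isomorphic under `X₀` (the [FrdII] Lem. 3.2 (iii)/(vii)
  input, supplied separately: irreducible linear rigid isometries out of a complex object are the slit
  morphisms into its isotropic hull), then `X` is an RC-anchor of `R` — by the two-kind criterion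
  `isAnchor_of_kinds` and the pull-back of finiteness `finite_isoClasses_of_functor` along
  `R[ℂ] → D[ℂ]` (`AnchorCriteria.lean`, seat abc-iut-w4-d027 gen 0).

No definitions; no statement of the paper is re-typed; nothing here bears on [IUTchIII] Cor. 3.12.
Seat abc-iut-w4-d027 (gen 2).
-/

namespace Literature.AlgebraicGeometry.Frobenioids

open CategoryTheory

noncomputable section

namespace ArchFrd

universe v u

variable {D : Type u} [Category.{v} D] (π : D ⥤ D0)

/-! ### Complex objects of `R` -/

/-- An object `X = (X₀, X_D)` of `R` is complex for the RC-structure `R → C → D → D₀` iff `π(X_D) = Spec ℂ`.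
[cite: MochizukiFrdII2008, Def 3.1 (v) p.24] -/
theorem R.complexObjects_iff (X : R π) :
    RC.complexObjects (R.toC π ⋙ PreFrobenioid.baseFunctor (C.toElem π) ⋙ baseRC π) X ↔
      (π.obj X.snd).IsComplex :=
  D0.isComplex_toArchBase_iff _

/-- For a complex object `X = (X₀, X_D)` of `R`, the base of `X₀` is `Spec ℂ` as well.
[cite: MochizukiFrdII2008, Def 3.1 (v) p.24] -/
theorem R.isComplex_toD0_fst (X : R π) (h : (π.obj X.snd).IsComplex) : (R0.toD0.obj X.fst).IsComplex :=
  D0.eq_complex_of_hom_complex (X.iso.hom ≫ eqToHom h)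

/-- The `D₀`-image of the `R₀`-component of an arrow of `R` into a complex object is invertible (every arrow
of `D₀` into `Spec ℂ` is an isomorphism). [cite: MochizukiFrdII2008, §3 p.23] -/
theorem R.isIso_toD0_map_fst {X Y : R π} (f : X ⟶ Y) (hY : (π.obj Y.snd).IsComplex) :
    IsIso (R0.toD0.map f.fst) :=
  D0.isIso_of_isComplex_target _ (R.isComplex_toD0_fst π Y hY)

/-- The `D₀`-image of the `D`-component of an arrow of `R` into a complex object is invertible.
[cite: MochizukiFrdII2008, §3 p.23] -/
theorem R.isIso_map_snd {X Y : R π} (f : X ⟶ Y) (hY : (π.obj Y.snd).IsComplex) :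
    IsIso (π.map f.snd) :=
  D0.isIso_of_isComplex_target _ hY

/-! ### The two kinds of irreducible arrows of `R[ℂ]` -/

section Kinds

variable {π}

/-- **An irreducible arrow `φ = (φ₀, φ_D)` of `R[ℂ]` has `φ₀` invertible or `φ_D` invertible**: it factors
through the complex object `(cod φ₀, dom φ_D)` as `(φ₀, id) ≫ (id, φ_D)` ("`φ` is either a pull-back
morphism or an isometric pre-step", [FrdII] p. 35 l. 31). [cite: MochizukiFrdII2008, Prop 3.5 (iii) p.34] -/
theorem R.fst_isIso_or_snd_isIso_of_irreducible
    {A B : RC.ComplexPart (R.toC π ⋙ PreFrobenioid.baseFunctor (C.toElem π) ⋙ baseRC π)}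
    (f : A ⟶ B) (hf : IsIrreducibleHom f) : IsIso f.hom.fst ∨ IsIso f.hom.snd := by
  have hB : (π.obj B.obj.snd).IsComplex := (R.complexObjects_iff π B.obj).mp B.property
  haveI := R.isIso_toD0_map_fst π f.hom hB
  -- the intermediate object `(cod φ₀, dom φ_D)` and the two factors
  let M : R π := ⟨B.obj.fst, A.obj.snd, (asIso (R0.toD0.map f.hom.fst)).symm ≪≫ A.obj.iso⟩
  let b : A.obj ⟶ M := ⟨f.hom.fst, 𝟙 _, by
    change R0.toD0.map f.hom.fst ≫ (inv (R0.toD0.map f.hom.fst) ≫ A.obj.iso.hom) =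
      A.obj.iso.hom ≫ π.map (𝟙 _)
    rw [IsIso.hom_inv_id_assoc, CategoryTheory.Functor.map_id, Category.comp_id]⟩
  let a : M ⟶ B.obj := ⟨𝟙 _, f.hom.snd, by
    change R0.toD0.map (𝟙 _) ≫ B.obj.iso.hom = (inv (R0.toD0.map f.hom.fst) ≫ A.obj.iso.hom) ≫ π.map f.hom.snd
    rw [CategoryTheory.Functor.map_id, Category.id_comp, Category.assoc, ← f.hom.w, IsIso.inv_hom_id_assoc]⟩
  have hM : RC.complexObjects (R.toC π ⋙ PreFrobenioid.baseFunctor (C.toElem π) ⋙ baseRC π) M :=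
    (R.complexObjects_iff π M).mpr ((R.complexObjects_iff π A.obj).mp A.property)
  have hfac : (ObjectProperty.homMk b : A ⟶ ⟨M, hM⟩) ≫ ObjectProperty.homMk a = f := by
    apply InducedCategory.hom_ext
    change b ≫ a = f.hom
    exact CFP.hom_ext (Category.comp_id _) (Category.id_comp _)
  rcases hf.2 _ _ hfac with ha | hb
  · right
    haveI : IsIso a := (ObjectProperty.isIso_hom_iff _).mpr ha
    exact CFP.isIso_snd a
  · left
    haveI : IsIso b := (ObjectProperty.isIso_hom_iff _).mpr hb
    exact CFP.isIso_fst b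

/-- **First kind**: if `φ = (φ₀, φ_D)` is irreducible in `R[ℂ]` with `φ₀` invertible, then `φ_D` is
irreducible in `D[ℂ]` (a factorisation of `φ_D` through a complex object lifts to one of `φ`).
[cite: MochizukiFrdII2008, Prop 3.5 (iii) p.34] -/
theorem R.irreducible_snd_of_irreducible
    {A B : RC.ComplexPart (R.toC π ⋙ PreFrobenioid.baseFunctor (C.toElem π) ⋙ baseRC π)}
    (f : A ⟶ B) (hf : IsIrreducibleHom f) [IsIso f.hom.fst] :
    IsIrreducibleHom
      (ObjectProperty.homMk f.hom.snd :
        (⟨A.obj.snd, A.property⟩ : RC.ComplexPart (baseRC π)) ⟶ ⟨B.obj.snd, B.property⟩) := by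
  have hB : (π.obj B.obj.snd).IsComplex := (R.complexObjects_iff π B.obj).mp B.property
  refine ⟨fun hiso => hf.1 ?_, fun Z β α hβα => ?_⟩
  · haveI : IsIso f.hom.snd := (ObjectProperty.isIso_hom_iff _).mpr hiso
    haveI : IsIso f.hom := CFP.isIso_of_isIso_fst_snd f.hom
    exact (ObjectProperty.isIso_hom_iff _).mp inferInstance
  · have hZ : (π.obj Z.obj).IsComplex := (D0.isComplex_toArchBase_iff _).mp Z.property
    have hcomp : β.hom ≫ α.hom = f.hom.snd := congrArg InducedCategory.Hom.hom hβα
    haveI : IsIso (π.map α.hom) := D0.isIso_of_isComplex_target _ hB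
    let M : R π := ⟨B.obj.fst, Z.obj, B.obj.iso ≪≫ (asIso (π.map α.hom)).symm⟩
    let b : A.obj ⟶ M := ⟨f.hom.fst, β.hom, by
      change R0.toD0.map f.hom.fst ≫ (B.obj.iso.hom ≫ inv (π.map α.hom)) = A.obj.iso.hom ≫ π.map β.hom
      rw [← Category.assoc, f.hom.w, ← hcomp, CategoryTheory.Functor.map_comp, Category.assoc,
        Category.assoc, IsIso.hom_inv_id, Category.comp_id]⟩
    let a : M ⟶ B.obj := ⟨𝟙 _, α.hom, by
      change R0.toD0.map (𝟙 _) ≫ B.obj.iso.hom = (B.obj.iso.hom ≫ inv (π.map α.hom)) ≫ π.map α.hom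
      rw [CategoryTheory.Functor.map_id, Category.id_comp, Category.assoc, IsIso.inv_hom_id, Category.comp_id]⟩
    have hM : RC.complexObjects (R.toC π ⋙ PreFrobenioid.baseFunctor (C.toElem π) ⋙ baseRC π) M :=
      (R.complexObjects_iff π M).mpr hZ
    have hfac : (ObjectProperty.homMk b : A ⟶ ⟨M, hM⟩) ≫ ObjectProperty.homMk a = f := by
      apply InducedCategory.hom_ext
      change b ≫ a = f.hom
      exact CFP.hom_ext (Category.comp_id _) hcomp
    rcases hf.2 _ _ hfac with ha | hb
    · left
      haveI : IsIso a := (ObjectProperty.isIso_hom_iff _).mpr ha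
      haveI : IsIso a.snd := CFP.isIso_snd a
      exact (ObjectProperty.isIso_hom_iff _).mp (show IsIso α.hom from inferInstance)
    · right
      haveI : IsIso b := (ObjectProperty.isIso_hom_iff _).mpr hb
      haveI : IsIso b.snd := CFP.isIso_snd b
      exact (ObjectProperty.isIso_hom_iff _).mp (show IsIso β.hom from inferInstance)

/-- **Second kind**: if `φ = (φ₀, φ_D)` is irreducible in `R[ℂ]` with `φ_D` invertible, then `φ₀` is
irreducible in `R₀` (a factorisation of `φ₀` — necessarily through a complex object — lifts to one of `φ`).
[cite: MochizukiFrdII2008, Prop 3.5 (iii) p.34] -/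
theorem R.irreducible_fst_of_irreducible
    {A B : RC.ComplexPart (R.toC π ⋙ PreFrobenioid.baseFunctor (C.toElem π) ⋙ baseRC π)}
    (f : A ⟶ B) (hf : IsIrreducibleHom f) [IsIso f.hom.snd] : IsIrreducibleHom f.hom.fst := by
  have hA : (π.obj A.obj.snd).IsComplex := (R.complexObjects_iff π A.obj).mp A.property
  have hB : (π.obj B.obj.snd).IsComplex := (R.complexObjects_iff π B.obj).mp B.property
  refine ⟨fun hiso => hf.1 ?_, fun W b₀ a₀ hba => ?_⟩
  · haveI := hiso
    haveI : IsIso f.hom := CFP.isIso_of_isIso_fst_snd f.hom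
    exact (ObjectProperty.isIso_hom_iff _).mp inferInstance
  · -- `W` is complex: it maps to the complex object `B₀`
    have hW : (R0.toD0.obj W).IsComplex :=
      D0.eq_complex_of_hom_complex (R0.toD0.map a₀ ≫ eqToHom (R.isComplex_toD0_fst π B.obj hB))
    haveI : IsIso (R0.toD0.map b₀) := D0.isIso_of_isComplex_target _ hW
    let M : R π := ⟨W, A.obj.snd, (asIso (R0.toD0.map b₀)).symm ≪≫ A.obj.iso⟩
    let b : A.obj ⟶ M := ⟨b₀, 𝟙 _, by
      change R0.toD0.map b₀ ≫ (inv (R0.toD0.map b₀) ≫ A.obj.iso.hom) = A.obj.iso.hom ≫ π.map (𝟙 _)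
      rw [IsIso.hom_inv_id_assoc, CategoryTheory.Functor.map_id, Category.comp_id]⟩
    let a : M ⟶ B.obj := ⟨a₀, f.hom.snd, by
      change R0.toD0.map a₀ ≫ B.obj.iso.hom = (inv (R0.toD0.map b₀) ≫ A.obj.iso.hom) ≫ π.map f.hom.snd
      rw [Category.assoc, ← f.hom.w, ← hba, CategoryTheory.Functor.map_comp, Category.assoc,
        IsIso.inv_hom_id_assoc]⟩
    have hM : RC.complexObjects (R.toC π ⋙ PreFrobenioid.baseFunctor (C.toElem π) ⋙ baseRC π) M :=
      (R.complexObjects_iff π M).mpr hA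
    have hfac : (ObjectProperty.homMk b : A ⟶ ⟨M, hM⟩) ≫ ObjectProperty.homMk a = f := by
      apply InducedCategory.hom_ext
      change b ≫ a = f.hom
      exact CFP.hom_ext hba (Category.id_comp _)
    rcases hf.2 _ _ hfac with ha | hb
    · left
      haveI : IsIso a := (ObjectProperty.isIso_hom_iff _).mpr ha
      exact CFP.isIso_fst a
    · right
      haveI : IsIso b := (ObjectProperty.isIso_hom_iff _).mpr hb
      exact CFP.isIso_fst b

/-- **Isomorphism under `X` from the components**: two arrows `f, g` out of `X` in `R[ℂ]` whose
`R₀`-components are isomorphic under `X₀` and whose `D`-components are isomorphic under `X_D` are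
isomorphic in `^X R[ℂ]` (the compatibility square of the component isomorphisms is automatic, the
`D₀`-image of `f₀` being invertible). [cite: MochizukiFrdII2008, Prop 3.5 (iii) p.34] -/
theorem R.nonempty_under_iso
    {A : RC.ComplexPart (R.toC π ⋙ PreFrobenioid.baseFunctor (C.toElem π) ⋙ baseRC π)}
    (f g : Under A) (t₀ : f.right.obj.fst ≅ g.right.obj.fst) (ht₀ : f.hom.hom.fst ≫ t₀.hom = g.hom.hom.fst)
    (t₁ : f.right.obj.snd ≅ g.right.obj.snd) (ht₁ : f.hom.hom.snd ≫ t₁.hom = g.hom.hom.snd) :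
    Nonempty (f ≅ g) := by
  have hfr : (π.obj f.right.obj.snd).IsComplex := (R.complexObjects_iff π f.right.obj).mp f.right.property
  haveI := R.isIso_toD0_map_fst π f.hom.hom hfr
  have w : R0.toD0.map t₀.hom ≫ g.right.obj.iso.hom = f.right.obj.iso.hom ≫ π.map t₁.hom := by
    rw [← cancel_epi (R0.toD0.map f.hom.hom.fst), ← Category.assoc, ← CategoryTheory.Functor.map_comp, ht₀,
      g.hom.hom.w, ← ht₁, CategoryTheory.Functor.map_comp, ← Category.assoc, ← f.hom.hom.w, Category.assoc]
  let t : f.right.obj ≅ g.right.obj := CFP.isoMk t₀ t₁ w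
  refine ⟨Under.isoMk (ObjectProperty.isoMk _ t) ?_⟩
  apply InducedCategory.hom_ext
  change f.hom.hom ≫ t.hom = g.hom.hom
  exact CFP.hom_ext ht₀ ht₁

end Kinds

/-! ### The anchor transfer -/

/-- **Anchor transfer for the rigidified angloid** ([FrdII] proof of Prop. 3.5 (iii), p. 35 ll. 28–40): let
`X = (X₀, X_D)` be an object of `R = R₀ ×_{D₀} D` with `X_D` an RC-anchor of `D`, and suppose that any two
irreducible arrows of `R₀` out of `X₀` with complex codomains are isomorphic under `X₀` (the input from
[FrdII] Lem. 3.2 (iii)/(vii): such arrows are the slit morphisms into the isotropic hull). Then `X` is an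
RC-anchor of `R`: every irreducible arrow of `R[ℂ]` out of `X` is of the first kind `(iso, φ_D)` — finitely
many classes, pulled back along `R[ℂ] → D[ℂ]` from the anchor `X_D` — or of the second kind `(φ₀, iso)` —
at most one class. [cite: MochizukiFrdII2008, Prop 3.5 (iii) p.34] -/
theorem R.isRCAnchor_of_isRCAnchor_snd (X : R π) (hX : RC.IsRCAnchor (baseRC π) X.snd)
    (hB : ∀ ⦃Y Y' : R0⦄ (k : X.fst ⟶ Y) (k' : X.fst ⟶ Y'), IsIrreducibleHom k → IsIrreducibleHom k' →
      (R0.toD0.obj Y).IsComplex → (R0.toD0.obj Y').IsComplex → ∃ t : Y ≅ Y', k ≫ t.hom = k') :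
    RC.IsRCAnchor (R.toC π ⋙ PreFrobenioid.baseFunctor (C.toElem π) ⋙ baseRC π) X := by
  obtain ⟨hc, hanch⟩ := hX
  have hcR : RC.complexObjects (R.toC π ⋙ PreFrobenioid.baseFunctor (C.toElem π) ⋙ baseRC π) X :=
    (R.complexObjects_iff π X).mpr ((D0.isComplex_toArchBase_iff _).mp hc)
  refine ⟨hcR, ?_⟩
  -- the complex parts and the projection `Ψ : R[ℂ] → D[ℂ]`
  let PR := R.toC π ⋙ PreFrobenioid.baseFunctor (C.toElem π) ⋙ baseRC π
  let A : RC.ComplexPart PR := ⟨X, hcR⟩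
  let Ψ : RC.ComplexPart PR ⥤ RC.ComplexPart (baseRC π) :=
    (RC.complexObjects (baseRC π)).lift ((RC.complexObjects PR).ι ⋙ R.toBase π)
      fun Y => Y.property
  refine isAnchor_of_kinds A (fun Y φ => IsIso φ.hom.fst ∧ IsIrreducibleHom φ)
    (fun Y φ => IsIso φ.hom.snd ∧ IsIrreducibleHom φ)
    (fun Y φ hφ => (R.fst_isIso_or_snd_isIso_of_irreducible φ hφ).imp (fun h => ⟨h, hφ⟩) fun h => ⟨h, hφ⟩)
    ?_ ?_
  · -- first kind: finiteness pulled back along `Ψ` from the anchor `X_D` of `D[ℂ]`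
    refine finite_isoClasses_of_functor Ψ A (fun Y φ => IsIso φ.hom.fst ∧ IsIrreducibleHom φ) ?_ ?_ hanch
    · rintro Y φ ⟨hφ₁, hφ⟩
      haveI := hφ₁
      exact R.irreducible_snd_of_irreducible φ hφ
    · rintro f g ⟨hf₁, -⟩ ⟨hg₁, -⟩ ⟨e⟩
      haveI := hf₁
      haveI := hg₁
      have hw : f.hom.hom.snd ≫ e.hom.right.hom = g.hom.hom.snd :=
        congrArg InducedCategory.Hom.hom (Under.w e.hom)
      exact R.nonempty_under_iso f g ((asIso f.hom.hom.fst).symm ≪≫ asIso g.hom.hom.fst)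
        (by rw [Iso.trans_hom, Iso.symm_hom, asIso_inv, asIso_hom, IsIso.hom_inv_id_assoc])
        ((RC.complexObjects (baseRC π)).ι.mapIso ((Under.forget _).mapIso e)) hw
  · -- second kind: at most one class (the input `hB`)
    refine Set.Subsingleton.finite ?_
    rintro x ⟨f, ⟨hf₂, hf⟩, rfl⟩ y ⟨g, ⟨hg₂, hg⟩, rfl⟩
    haveI := hf₂
    haveI := hg₂
    have hfirr : IsIrreducibleHom f.hom.hom.fst := R.irreducible_fst_of_irreducible f.hom hf
    have hgirr : IsIrreducibleHom g.hom.hom.fst := R.irreducible_fst_of_irreducible g.hom hg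
    have hfc : (R0.toD0.obj f.right.obj.fst).IsComplex :=
      R.isComplex_toD0_fst π f.right.obj ((R.complexObjects_iff π f.right.obj).mp f.right.property)
    have hgc : (R0.toD0.obj g.right.obj.fst).IsComplex :=
      R.isComplex_toD0_fst π g.right.obj ((R.complexObjects_iff π g.right.obj).mp g.right.property)
    obtain ⟨t₀, ht₀⟩ := hB f.hom.hom.fst g.hom.hom.fst hfirr hgirr hfc hgc
    obtain ⟨i⟩ := R.nonempty_under_iso f g t₀ ht₀ ((asIso f.hom.hom.snd).symm ≪≫ asIso g.hom.hom.snd)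
      (by rw [Iso.trans_hom, Iso.symm_hom, asIso_inv, asIso_hom, IsIso.hom_inv_id_assoc])
    exact Quotient.sound ⟨i⟩

end ArchFrd

end

end Literature.AlgebraicGeometry.Frobenioids
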